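import Summits.ValiantsHypothesis.ValiantsHypothesis.Theorems.LacunarySymmetroidMatrixDescartesCensusV20SoundFarkas

/-!
# `MatrixDescartes` census — soundness of the `V = 20` certificate checker: the three certificate kinds (`lp`, `dom`, `sign`) refute every model — `V20.certOK_sound`

HONEST FRAMING.  Object-search cell `pub-symmetroid`; door-A item `DoorA26 = PosRootLawAt 2 6 19`
(stmt-ValiantsHypothesis-19979; OPEN, typed, never asserted).  Part of the proof that a certificate accepted by `V20.checkCell` (`…CensusV20Check`) excludes a twenty — `20 = D(2,6)` distinct
positive det-roots of a six-term real symmetric `2 × 2` pencil — on its support (semantics: `…CensusV20Model`).  Nothing here bears on `V = 19`, on `ζ_sym(2,6)` over all supports, on `DoorA26` itself, on `MatrixDescartes`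
(stmt-ValiantsHypothesis-18050) or on `VP ≠ VNP`.

[folklore] Certificate-checker soundness / replay; elementary.
-/

-- the D-0017 layout repeats a namespace component (single-conjunct summit); the `dupNamespace` linter flags it; name mandated.
set_option linter.dupNamespace false

namespace Summit.ValiantsHypothesis.ValiantsHypothesis.Theorems.LacunarySymmetroidMatrixDescartes.Census.V20

section Certs

open Finset

variable {dl : List ℕ} {ord : List Atom} {s : Bool} {x : ℕ → ℝ} {v : Atom → ℝ}

/-! ### LP certificates -/

/-- An accepted Farkas certificate refutes the model. [folklore] -/
theorem lpOK_sound (M : Model dl ord s x v) {specs : List (RowSpec × ℕ)} (h : lpOK dl ord s specs = true) : False := by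
  unfold lpOK at h
  split at h
  · simp at h
  · next rs hrs =>
    simp only [Bool.and_eq_true, decide_eq_true_eq] at h
    obtain ⟨hbal, hlt⟩ := h
    obtain ⟨-, -, hB, PL, PR, Cd, Cn, hPL, hCn, hCd, e1, e2, e3, hle⟩ := accumulate_sound M hrs
    have hPLR : PL = PR := by rw [← e1, ← e2, hbal]
    have hratio : Cd ≤ Cn := le_of_mul_le_mul_left (a := PL) (by rw [hPLR] at hle ⊢; exact hle) hPL
    obtain ⟨hf, hden⟩ := frval_eq_numZ_div_denZ hB
    rw [e3] at hf
    -- `Cd / Cn = numZ / denZ` with `Cd ≤ Cn` forces `numZ ≤ denZ`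
    have hdenR : (0 : ℝ) < denZ (accumulate rs).2.2 := by exact_mod_cast hden
    have h1 : Cd / Cn ≤ 1 := (div_le_one hCn).2 hratio
    rw [hf] at h1
    have h2 : (numZ (accumulate rs).2.2 : ℝ) ≤ denZ (accumulate rs).2.2 := by
      rwa [div_le_one hdenR] at h1
    have h3 : numZ (accumulate rs).2.2 ≤ denZ (accumulate rs).2.2 := by exact_mod_cast h2
    omega

/-! ### Domination certificates -/

/-- One competitor: the bound `|t_k| · ud ≤ un · |t₀|`. [folklore] -/
theorem compOK_sound (M : Model dl ord s x v) {P : PolySpec} (hval : P.valid = true) {n0 ud : ℕ}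
    (hn0 : n0 < P.poly.length) (hud : 0 < ud) {c : Comp} (hk : c.k < P.poly.length)
    (h : compOK dl ord s P.poly n0 ud c = true) :
    |tval v (P.poly.getD c.k (0, []))| * ud ≤ c.un * |tval v (P.poly.getD n0 (0, []))| := by
  unfold compOK at h
  split at h
  · simp at h
  · next rs hrs =>
    simp only [Bool.and_eq_true, decide_eq_true_eq] at h
    obtain ⟨⟨⟨hD, hun⟩, hbal⟩, hle⟩ := h
    obtain ⟨hl1, hl2, hB, PL, PR, Cd, Cn, hPL, hCn, hCd, e1, e2, e3, hrow⟩ := accumulate_sound M hrs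
    have hT0a := atoms_valid P hval _ (term_getD_mem P.poly hn0)
    have hTka := atoms_valid P hval _ (term_getD_mem P.poly hk)
    have hg0 : (P.poly.getD n0 (0, [])).1 ≠ 0 := coeff_ne_zero P _ (term_getD_mem P.poly hn0)
    have hgk : (P.poly.getD c.k (0, [])).1 ≠ 0 := coeff_ne_zero P _ (term_getD_mem P.poly hk)
    rw [abs_tval_eq M.xpos M.hv _ hT0a, abs_tval_eq M.xpos M.hv _ hTka]
    -- names
    set G0 : ℝ := |((P.poly.getD n0 (0, [])).1 : ℝ)| with hG0
    set Gk : ℝ := |((P.poly.getD c.k (0, [])).1 : ℝ)| with hGk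
    set m0 := lprod x (posl ord (P.poly.getD n0 (0, [])).2) with hm0
    set mk := lprod x (posl ord (P.poly.getD c.k (0, [])).2) with hmk
    have hm0p : 0 < m0 := lprod_pos M.xpos _
    have hmkp : 0 < mk := lprod_pos M.xpos _
    have hG0p : 0 < G0 := by rw [hG0]; exact abs_pos.2 (by exact_mod_cast hg0)
    have hGkp : 0 < Gk := by rw [hGk]; exact abs_pos.2 (by exact_mod_cast hgk)
    have hudR : (0 : ℝ) < ud := by exact_mod_cast hud
    have hunR : (0 : ℝ) < c.un := by exact_mod_cast hun
    -- exponent balance: `PL · m0^D = PR · mk^D`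
    have hbal' : PL * m0 ^ c.D = PR * mk ^ c.D := by
      have h1 := xpow_bumps x (accumulate rs).1 (posl ord (P.poly.getD n0 (0, [])).2) c.D
        (fun p hp => by rw [hl1]; exact posl_lt_21 M hT0a p hp)
      have h2 := xpow_bumps x (accumulate rs).2.1 (posl ord (P.poly.getD c.k (0, [])).2) c.D
        (fun p hp => by rw [hl2]; exact posl_lt_21 M hTka p hp)
      rw [← e1, ← e2, ← h1, ← h2, hbal]
    -- constants: the checked comparison says `frval A ≥ 1`
    have hb1 : ∀ be ∈ [(c.un * (P.poly.getD n0 (0, [])).1.natAbs, c.D)], 0 < be.1 := by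
      intro be hbe; simp only [List.mem_singleton] at hbe; subst hbe
      exact Nat.mul_pos hun (Int.natAbs_pos.2 hg0)
    have hb2 : ∀ be ∈ [((P.poly.getD c.k (0, [])).1.natAbs * ud, c.D)], 0 < be.1 := by
      intro be hbe; simp only [List.mem_singleton] at hbe; subst hbe
      exact Nat.mul_pos (Int.natAbs_pos.2 hgk) hud
    have hm := frval_mulF hb1 1 hB
    have hd := frval_divF hb2 1 hm.2
    obtain ⟨hf, hden⟩ := frval_eq_numZ_div_denZ hd.2
    have hdenR : (0 : ℝ) < denZ (divF (mulF (accumulate rs).2.2 [(c.un * (P.poly.getD n0 (0, [])).1.natAbs, c.D)] 1)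
        [((P.poly.getD c.k (0, [])).1.natAbs * ud, c.D)] 1) := by exact_mod_cast hden
    have hge : (1 : ℝ) ≤ frval (divF (mulF (accumulate rs).2.2 [(c.un * (P.poly.getD n0 (0, [])).1.natAbs, c.D)] 1)
        [((P.poly.getD c.k (0, [])).1.natAbs * ud, c.D)] 1) := by
      rw [hf, le_div_iff₀ hdenR, one_mul]; exact_mod_cast hle
    rw [hd.1, hm.1, e3, fval_singleton, fval_singleton, pow_one, pow_one] at hge
    push_cast at hge
    rw [Nat.cast_natAbs, Int.cast_abs, Nat.cast_natAbs, Int.cast_abs] at hge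
    -- `hge : 1 ≤ Cd / Cn * (un * G0)^D / (Gk * ud)^D`
    have hX : 0 < (Gk * ud) ^ c.D := by positivity
    have hi : Cn * (Gk * ud) ^ c.D ≤ Cd * (c.un * G0) ^ c.D := by
      have := hge
      rw [le_div_iff₀ hX, one_mul, div_mul_eq_mul_div, le_div_iff₀ hCn] at this
      linarith
    -- combine with the rows `PL · Cd ≤ PR · Cn` and the balance
    have hii : PL * (Gk * ud) ^ c.D ≤ PR * (c.un * G0) ^ c.D := by
      have h1 : PL * (Cn * (Gk * ud) ^ c.D) ≤ PL * (Cd * (c.un * G0) ^ c.D) := mul_le_mul_of_nonneg_left hi hPL.le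
      have h2 : PL * Cd * (c.un * G0) ^ c.D ≤ PR * Cn * (c.un * G0) ^ c.D :=
        mul_le_mul_of_nonneg_right hrow (by positivity)
      nlinarith
    have hiii : (mk * Gk * ud) ^ c.D ≤ (m0 * c.un * G0) ^ c.D := by
      have h1 : PL * mk ^ c.D * (Gk * ud) ^ c.D ≤ PR * mk ^ c.D * (c.un * G0) ^ c.D := by
        nlinarith [pow_pos hmkp c.D]
      rw [show PR * mk ^ c.D = PL * m0 ^ c.D from hbal'.symm] at h1
      have h1' : PL * (mk ^ c.D * (Gk * ud) ^ c.D) ≤ PL * (m0 ^ c.D * (c.un * G0) ^ c.D) := by linarith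
      have h2 : mk ^ c.D * (Gk * ud) ^ c.D ≤ m0 ^ c.D * (c.un * G0) ^ c.D := le_of_mul_le_mul_left h1' hPL
      simp only [mul_pow] at h2 ⊢
      linarith
    have hfin : mk * Gk * ud ≤ m0 * c.un * G0 :=
      (pow_le_pow_iff_left₀ (by positivity) (by positivity) (by omega)).1 hiii
    nlinarith

/-- An accepted domination certificate refutes the model. [folklore] -/
theorem domOK_sound (M : Model dl ord s x v) {P : PolySpec} {n0 ud : ℕ} {comps : List Comp}
    (h : domOK dl ord s P n0 ud comps = true) : False := by
  classical
  unfold domOK at h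
  simp only [Bool.and_eq_true, decide_eq_true_eq, List.all_eq_true] at h
  obtain ⟨⟨⟨⟨⟨⟨⟨⟨⟨hval, hdef⟩, hn0⟩, hneg⟩, hud⟩, hcov⟩, hpos⟩, hnd⟩, hsum⟩, hall⟩ := h
  have hP : 0 ≤ pval v P.poly := by
    refine pval_nonneg M P hval fun i j hij => ?_
    subst hij; simpa [PolySpec.defOK] using hdef
  set w : ℕ → ℝ := fun n => tval v (P.poly.getD n (0, [])) with hw
  -- (1) the competitors' bounds add up to `∑ |w c.k| < |w n0|`
  have hT0a := atoms_valid P hval _ (term_getD_mem P.poly hn0)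
  have hg0 : (P.poly.getD n0 (0, [])).1 ≠ 0 := coeff_ne_zero P _ (term_getD_mem P.poly hn0)
  have hw0 : 0 < |w n0| := by
    rw [hw]; simp only
    rw [abs_tval_eq M.xpos M.hv _ hT0a]
    exact mul_pos (abs_pos.2 (by exact_mod_cast hg0)) (lprod_pos M.xpos _)
  have hklt : ∀ c ∈ comps, c.k < P.poly.length := by
    intro c hc
    have := hpos c hc
    unfold posTerms at this
    exact List.mem_range.1 (List.mem_filter.1 this).1
  have hbounds : (comps.map fun c => |w c.k| * ud).sum ≤ (comps.map fun c => (c.un : ℝ) * |w n0|).sum :=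
    List.sum_le_sum fun c hc => compOK_sound M hval hn0 hud (hklt c hc) (hall c hc)
  have hsumR : ((comps.map Comp.un).sum : ℝ) < ud := by exact_mod_cast hsum
  have hlt : (comps.map fun c => |w c.k|).sum < |w n0| := by
    have e1 : (comps.map fun c => |w c.k| * ud).sum = (comps.map fun c => |w c.k|).sum * ud := by
      rw [List.sum_map_mul_right]
    have e2 : (comps.map fun c => (c.un : ℝ) * |w n0|).sum = ((comps.map Comp.un).sum : ℝ) * |w n0| := by
      push_cast
      rw [List.map_map, ← List.sum_map_mul_right]
      rfl
    rw [e1, e2] at hbounds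
    have hudR : (0 : ℝ) < ud := by exact_mod_cast hud
    nlinarith
  -- (2) `P ≥ 0` gives `|w n0| ≤ ∑_{positive terms} w ≤ ∑_{competitors} |w c.k|`
  set posS := (posTerms ord s P.poly).toFinset with hposS
  have hposSub : posS ⊆ Finset.range P.poly.length := by
    intro n hn
    rw [hposS, List.mem_toFinset] at hn
    unfold posTerms at hn
    exact Finset.mem_range.2 (List.mem_range.1 (List.mem_filter.1 hn).1)
  have hrest : ∀ n ∈ Finset.range P.poly.length \ posS, w n ≤ 0 := by
    intro n hn
    rw [Finset.mem_sdiff, Finset.mem_range, hposS, List.mem_toFinset] at hn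
    have htn : termNeg ord s (P.poly.getD n (0, [])) = true := by
      have := (mem_posTerms_iff (ord := ord) (s := s) hn.1).not.1 hn.2
      simpa using this
    exact tval_nonpos_of_termNeg M.xpos M.hv _ (atoms_valid P hval _ (term_getD_mem P.poly hn.1)) htn
  have hn0rest : n0 ∈ Finset.range P.poly.length \ posS := by
    rw [Finset.mem_sdiff, Finset.mem_range, hposS, List.mem_toFinset]
    refine ⟨hn0, fun hmem => ?_⟩
    have := (mem_posTerms_iff (ord := ord) (s := s) hn0).1 hmem
    rw [this] at hneg
    exact Bool.false_ne_true hneg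
  have hsplit : pval v P.poly = ∑ n ∈ posS, w n + ∑ n ∈ Finset.range P.poly.length \ posS, w n := by
    rw [pval_eq_sum_range, ← Finset.sum_sdiff hposSub, add_comm]
  have hrestle : ∑ n ∈ Finset.range P.poly.length \ posS, w n ≤ w n0 := by
    rw [← Finset.add_sum_erase _ _ hn0rest]
    have : ∑ n ∈ (Finset.range P.poly.length \ posS).erase n0, w n ≤ 0 :=
      Finset.sum_nonpos fun n hn => hrest n (Finset.mem_of_mem_erase hn)
    linarith
  have hposle : ∑ n ∈ posS, w n ≤ (comps.map fun c => |w c.k|).sum := by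
    have hsub2 : posS ⊆ (comps.map Comp.k).toFinset := by
      intro n hn
      rw [hposS, List.mem_toFinset] at hn
      obtain ⟨c, hc, hck⟩ := hcov n hn
      rw [List.mem_toFinset, List.mem_map]
      exact ⟨c, hc, hck⟩
    calc ∑ n ∈ posS, w n ≤ ∑ n ∈ posS, |w n| := Finset.sum_le_sum fun n _ => le_abs_self _
      _ ≤ ∑ n ∈ (comps.map Comp.k).toFinset, |w n| :=
          Finset.sum_le_sum_of_subset_of_nonneg hsub2 fun n _ _ => abs_nonneg _
      _ = ((comps.map Comp.k).map fun n => |w n|).sum := List.sum_toFinset _ hnd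
      _ = (comps.map fun c => |w c.k|).sum := by rw [List.map_map]; rfl
  have hw0le : w n0 ≤ 0 := hrest n0 hn0rest
  have : |w n0| = -w n0 := abs_of_nonpos hw0le
  linarith

/-! ### Sign certificates -/

/-- An accepted odd definite triangle refutes the model. [folklore] -/
theorem signOK_sound (M : Model dl ord s x v) {i j k : ℕ} (h : signOK ord s i j k = true) : False := by
  unfold signOK at h
  simp only [Bool.and_eq_true, decide_eq_true_eq, Bool.not_eq_true'] at h
  obtain ⟨⟨⟨⟨⟨hij, hjk, hk6⟩, hi⟩, hj⟩, hk⟩, hodd⟩ := h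
  have hi6 : i < 6 := by omega
  have hj6 : j < 6 := by omega
  have htri := M.tri i j k hij hjk hk6 ((M.v_qA_pos_iff hi6).2 hi) ((M.v_qA_pos_iff hj6).2 hj)
    ((M.v_qA_pos_iff hk6).2 hk)
  have hprod := prod_map_sgn_mul x s ord [cA i j, cA j k, cA i k]
  simp only [List.map_cons, List.map_nil, List.prod_cons, List.prod_nil, mul_one] at hprod
  rw [← M.hv _ (cA_mem hi6 hj6), ← M.hv _ (cA_mem hj6 hk6), ← M.hv _ (cA_mem hi6 hk6)] at hprod
  simp only [hodd, ite_true] at hprod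
  have hl := lprod_pos M.xpos (posl ord [cA i j, cA j k, cA i k])
  nlinarith

/-- **Soundness of the certificate checker (abstract form)**: no model passes an accepted certificate. [folklore] -/
theorem certOK_sound (M : Model dl ord s x v) {c : Cert} (h : certOK dl ord s c = true) : False := by
  cases c with
  | sign i j k => exact signOK_sound M h
  | lp rows => exact lpOK_sound M h
  | dom P n0 ud comps => exact domOK_sound M h

end Certs

end Summit.ValiantsHypothesis.ValiantsHypothesis.Theorems.LacunarySymmetroidMatrixDescartes.Census.V20
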